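import Literature.Analysis.OperatorTheory.Enflo2023.RoomClaim
import HarnessLib

/-!
# Enflo 2023, v2 p.20 after (46): the room claim with finitely many exact constraints, refuted

Source under adjudication: Per H. Enflo, *On the invariant subspace problem in Hilbert spaces*, arXiv:2305.15442 (v1
2023, v2 2024), bib key `Enflo2023` — a CLAIMED proof of the invariant subspace problem for operators on a separable
Hilbert space.  This file is part of the kernel-tight typing of the manuscript by the b2b-enflo repair cell
(formaliser 2, Part B: (28)–(47), the limiting argument and the final deduction).  It records what FOLLOWS (proved
implications from the manuscript's displayed hypotheses) and, where a step does not follow, the typed inference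
together with its refutation.  NOTHING here asserts that the manuscript's main theorem holds; no declaration concludes
the invariant subspace problem for an arbitrary operator.  Value (BLOCK-2b): theorems / refutations of typed
inferences about a text — not progress on the problem.

EnfloISP — Part B (formaliser 2).  THE GAP, census row R2: finitely many exact linear constraints do not help.

v2 p.20 (after (46)) continues: "We now repeat … w₀₁ … The room for variation of [ ]⁻¹_n x₀ is less than δ₂^400.
By continuing with smaller and smaller (εθ)'s, w₀₀, w₀₁, w₀₂, … we have that V_{y_n}V_{y_n}^*[ ]⁻¹_n x₀ converges",
i.e. the confinement is supposed to come from orthogonality of the MC changes to a growing FINITE family of test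
vectors.  `RoomClaimFin k ρ` is `RoomClaim ρ` (Gap.lean) with `k` constraint vectors imposed on EVERY step, and — to
make the constraints as informative as possible — required orthonormal and orthogonal to `x₀`.  It is false for every
`k` and every `ρ < 0.6` (`not_roomClaimFin`): the model of Gap.lean runs unchanged in the two directions left free in
`EuclideanSpace ℂ (Fin 3 ⊕ Fin k)` (index `inl 0` = x₀, `inl 1`, `inl 2` = the alternating step directions, `inr i` = the
constraints).  Moral (GAP.md / REPAIR-CENSUS.md §Formaliser 2, R2): exact linear constraints, in any finite number,
leave an infinite-dimensional (here: two-dimensional suffices) freedom for the increments; what is missing is an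
estimate making the steps summable, not more constraints.
STATUS: CLOSED (zero sorry).
-/

open scoped InnerProductSpace
open Filter Topology RCLike

namespace Literature.Analysis.OperatorTheory.Enflo2023

/-- The room claim with `k` exact constraint directions `w i` (orthonormal, orthogonal to `x₀`), all imposed on
every step; otherwise verbatim `RoomClaim`. -/
@[claim "Enflo2023" "disputed"]
def RoomClaimFin (k : ℕ) (ρ : ℝ) : Prop :=
  ∀ (H : Type) [NormedAddCommGroup H] [InnerProductSpace ℂ H] [CompleteSpace H]
    (x₀ : H) (w : Fin k → H) (v : ℕ → H) (εθ : ℕ → ℝ) (β : ℝ),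
    ‖x₀‖ = 1 → Orthonormal ℂ w → (∀ i, ⟪x₀, w i⟫_ℂ = 0) → 0 < β → β < 1 →
    (∀ n, (0.3 : ℝ) ≤ re ⟪x₀, v n⟫_ℂ ∧ re ⟪x₀, v n⟫_ℂ ≤ 0.7) →
    (∀ n, (εθ n : ℂ) = ⟪v n, x₀ - v n⟫_ℂ) →
    (∀ n, 0 < εθ n) → StrictAnti εθ → Tendsto εθ atTop (𝓝 0) →
    (∀ n, εθ (n + 1) ≤ (1 - β) * εθ n) →
    (∀ n, ‖⟪x₀, v (n + 1) - v n⟫_ℂ‖ ≤ 10 * β * εθ n) →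
    (∀ i n, ⟪w i, v (n + 1) - v n⟫_ℂ = 0) →
    ∀ n, ‖v n - v 0‖ ≤ ρ

/-! ### The model of Gap.lean over an arbitrary orthonormal family -/

namespace RoomModel

variable {H : Type*} [NormedAddCommGroup H] [InnerProductSpace ℂ H]
variable {ι : Type*} [DecidableEq ι]

/-- moving direction: `e i₁` at even steps, `e i₂` at odd steps. [cite: Enflo2023, v2 p.20, after (46)] -/
noncomputable def uG (e : ι → H) (i₁ i₂ : ι) (n : ℕ) : H := if Even n then e i₁ else e i₂

/-- the model sequence `v n = (2/5)·e i₀ + d_n·u_n` (`d_n = √(0.24 − (εθ)_n)`, `(εθ)_n = 10⁻²·2⁻ⁿ` from Gap.lean). [cite: Enflo2023, v2 p.20, after (46)] -/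
noncomputable def vG (e : ι → H) (i₀ i₁ i₂ : ι) (n : ℕ) : H :=
  ((2 / 5 : ℝ) : ℂ) • e i₀ + ((dModel n : ℝ) : ℂ) • uG e i₁ i₂ n

variable {e : ι → H} (he : Orthonormal ℂ e) {i₀ i₁ i₂ : ι}
include he

/-- Inner products of the orthonormal frame `e` (general index type). [cite: Enflo2023, v2 p.20, after (46)] -/
private lemma eG_inner (i j : ι) : ⟪e i, e j⟫_ℂ = if i = j then 1 else 0 :=
  orthonormal_iff_ite.mp he i j

/-- any family vector other than the two step directions is orthogonal to `u_n`. [cite: Enflo2023, v2 p.20, after (46)] -/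
lemma inner_e_uG {c : ι} (hc1 : c ≠ i₁) (hc2 : c ≠ i₂) (n : ℕ) : ⟪e c, uG e i₁ i₂ n⟫_ℂ = 0 := by
  unfold uG; split_ifs <;> simp [eG_inner he, hc1, hc2]

/-- Model (general frame): `⟪u_n, e c⟫ = 0` for `c` off the two moving indices. [cite: Enflo2023, v2 p.20, after (46)] -/
lemma inner_uG_e {c : ι} (hc1 : c ≠ i₁) (hc2 : c ≠ i₂) (n : ℕ) : ⟪uG e i₁ i₂ n, e c⟫_ℂ = 0 := by
  rw [← inner_conj_symm, inner_e_uG he hc1 hc2, map_zero]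

/-- Model (general frame): `u_n` is a unit vector. [cite: Enflo2023, v2 p.20, after (46)] -/
lemma inner_uG_self (n : ℕ) : ⟪uG e i₁ i₂ n, uG e i₁ i₂ n⟫_ℂ = 1 := by
  unfold uG; split_ifs <;> (rw [eG_inner he]; simp)

/-- Model (general frame): consecutive directions are orthogonal. [cite: Enflo2023, v2 p.20, after (46)] -/
lemma inner_uG_succ (h12 : i₁ ≠ i₂) (n : ℕ) : ⟪uG e i₁ i₂ n, uG e i₁ i₂ (n + 1)⟫_ℂ = 0 := by
  unfold uG
  rcases Nat.even_or_odd n with h | h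
  · have h' : ¬ Even (n + 1) := by rw [Nat.not_even_iff_odd]; exact h.add_one
    simp [h, h', eG_inner he, h12]
  · have h' : Even (n + 1) := h.add_one
    have h'' : ¬ Even n := by rw [Nat.not_even_iff_odd]; exact h
    simp [h', h'', eG_inner he, h12.symm]

/-- Model (general frame): `⟪x₀, v_n⟫ = 2/5`. [cite: Enflo2023, v2 p.20, after (46)] -/
lemma inner_x0_vG (h01 : i₀ ≠ i₁) (h02 : i₀ ≠ i₂) (n : ℕ) :
    ⟪e i₀, vG e i₀ i₁ i₂ n⟫_ℂ = (2 / 5 : ℝ) := by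
  unfold vG
  rw [inner_add_right, inner_smul_right, inner_smul_right, inner_e_uG he h01 h02, eG_inner he]
  simp

/-- Model (general frame): `‖v_n‖² = (2/5)² + d_n²`. [cite: Enflo2023, v2 p.20, after (46)] -/
lemma inner_vG_vG (h01 : i₀ ≠ i₁) (h02 : i₀ ≠ i₂) (n : ℕ) :
    ⟪vG e i₀ i₁ i₂ n, vG e i₀ i₁ i₂ n⟫_ℂ = (((2 / 5 : ℝ) ^ 2 + dModel n ^ 2 : ℝ) : ℂ) := by
  unfold vG
  simp only [inner_add_left, inner_add_right, inner_smul_left, inner_smul_right, inner_e_uG he h01 h02,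
    inner_uG_e he h01 h02, inner_uG_self he, eG_inner he, Complex.conj_ofReal]
  push_cast
  ring

/-- Model (general frame): `⟨v_n, x₀ − v_n⟩ = (εθ)_n`. [cite: Enflo2023, v2 p.20, after (46)] -/
lemma inner_vG_x0_sub_vG (h01 : i₀ ≠ i₁) (h02 : i₀ ≠ i₂) (n : ℕ) :
    ⟪vG e i₀ i₁ i₂ n, e i₀ - vG e i₀ i₁ i₂ n⟫_ℂ = (epsModel n : ℂ) := by
  rw [inner_sub_right, inner_vG_vG he h01 h02, ← inner_conj_symm, inner_x0_vG he h01 h02]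
  have := dModel_sq n
  simp only [Complex.conj_ofReal]
  norm_cast
  rw [this]; ring

omit he [DecidableEq ι] in
/-- Model (general frame): the step `v_{n+1} − v_n = d_{n+1}u_{n+1} − d_nu_n`. [cite: Enflo2023, v2 p.20, after (46)] -/
lemma vG_succ_sub (n : ℕ) : vG e i₀ i₁ i₂ (n + 1) - vG e i₀ i₁ i₂ n
    = ((dModel (n + 1) : ℝ) : ℂ) • uG e i₁ i₂ (n + 1) - ((dModel n : ℝ) : ℂ) • uG e i₁ i₂ n := by
  unfold vG; abel

/-- every family vector other than the two step directions — `x₀ = e i₀` and all constraints — is orthogonal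
to every increment. [cite: Enflo2023, v2 p.20, after (46)] -/
lemma inner_e_stepG {c : ι} (hc1 : c ≠ i₁) (hc2 : c ≠ i₂) (n : ℕ) :
    ⟪e c, vG e i₀ i₁ i₂ (n + 1) - vG e i₀ i₁ i₂ n⟫_ℂ = 0 := by
  rw [vG_succ_sub, inner_sub_right, inner_smul_right, inner_smul_right, inner_e_uG he hc1 hc2,
    inner_e_uG he hc1 hc2]; simp

/-- Model (general frame): `‖v_{n+1} − v_n‖² = 0.48 − (εθ)_{n+1} − (εθ)_n`. [cite: Enflo2023, v2 p.20, after (46)] -/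
lemma norm_stepG_sq (h12 : i₁ ≠ i₂) (n : ℕ) :
    ‖vG e i₀ i₁ i₂ (n + 1) - vG e i₀ i₁ i₂ n‖ ^ 2 = 0.48 - epsModel (n + 1) - epsModel n := by
  have key : (⟪vG e i₀ i₁ i₂ (n + 1) - vG e i₀ i₁ i₂ n, vG e i₀ i₁ i₂ (n + 1) - vG e i₀ i₁ i₂ n⟫_ℂ)
      = ((dModel (n + 1) ^ 2 + dModel n ^ 2 : ℝ) : ℂ) := by
    rw [vG_succ_sub]
    have h1 := inner_uG_succ he h12 n
    have h2 : ⟪uG e i₁ i₂ (n + 1), uG e i₁ i₂ n⟫_ℂ = 0 := by rw [← inner_conj_symm, h1, map_zero]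
    simp only [inner_sub_left, inner_sub_right, inner_smul_left, inner_smul_right, inner_uG_self he, h1,
      h2, Complex.conj_ofReal]
    push_cast; ring
  have h := @inner_self_eq_norm_sq_to_K ℂ H _ _ _ (vG e i₀ i₁ i₂ (n + 1) - vG e i₀ i₁ i₂ n)
  rw [h] at key
  have key' : (‖vG e i₀ i₁ i₂ (n + 1) - vG e i₀ i₁ i₂ n‖ ^ 2 : ℝ) = dModel (n + 1) ^ 2 + dModel n ^ 2 := by
    apply Complex.ofReal_injective
    push_cast
    first | exact key | simpa using key
  rw [key', dModel_sq, dModel_sq]; ring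

/-- Model (general frame): every step has length `≥ 0.67`. [cite: Enflo2023, v2 p.20, after (46)] -/
lemma norm_stepG_ge (h12 : i₁ ≠ i₂) (n : ℕ) : (0.67 : ℝ) ≤ ‖vG e i₀ i₁ i₂ (n + 1) - vG e i₀ i₁ i₂ n‖ := by
  have h := norm_stepG_sq he (i₀ := i₀) h12 n
  have h1 := epsModel_le (n + 1); have h2 := epsModel_le n
  nlinarith [norm_nonneg (vG e i₀ i₁ i₂ (n + 1) - vG e i₀ i₁ i₂ n)]

/-- The generalised model is not Cauchy either. [cite: Enflo2023, v2 p.20, after (46)] -/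
theorem modelG_not_cauchySeq (h12 : i₁ ≠ i₂) : ¬ CauchySeq (vG e i₀ i₁ i₂) := by
  intro hc
  obtain ⟨N, hN⟩ := Metric.cauchySeq_iff.mp hc (1 / 2) (by norm_num)
  have h := hN (N + 1) (by omega) N le_rfl
  rw [dist_eq_norm] at h
  have := norm_stepG_ge he (i₀ := i₀) h12 N
  linarith

end RoomModel

open RoomModel in
/-- Every hypothesis of `RoomClaimFin k` holds for the model indexed by `Fin 3 ⊕ Fin k` (x₀ = e (inl 0), step
directions e (inl 1), e (inl 2), constraints w i = e (inr i), β = 1/2), yet ‖v₁ − v₀‖ ≥ 0.67. [cite: Enflo2023, v2 p.20, after (46)] -/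
theorem modelFin_violates (k : ℕ) (ρ : ℝ) (hρ : ρ < 0.6) (hRC : RoomClaimFin k ρ)
    (H' : Type) [NormedAddCommGroup H'] [InnerProductSpace ℂ H'] [CompleteSpace H']
    (e' : Fin 3 ⊕ Fin k → H') (he' : Orthonormal ℂ e') : False := by
  have h01 : (Sum.inl 0 : Fin 3 ⊕ Fin k) ≠ Sum.inl 1 := by simp
  have h02 : (Sum.inl 0 : Fin 3 ⊕ Fin k) ≠ Sum.inl 2 := by simp
  have h12 : (Sum.inl 1 : Fin 3 ⊕ Fin k) ≠ Sum.inl 2 := by simp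
  have hx₀ : ‖e' (Sum.inl 0)‖ = 1 := he'.1 _
  have hw : Orthonormal ℂ (fun i : Fin k => e' (Sum.inr i)) :=
    he'.comp _ Sum.inr_injective
  have hxw : ∀ i : Fin k, ⟪e' (Sum.inl 0), e' (Sum.inr i)⟫_ℂ = 0 := by
    intro i; rw [orthonormal_iff_ite.mp he']; simp
  have H1 : ∀ n, (0.3 : ℝ) ≤ re ⟪e' (Sum.inl 0), vG e' (Sum.inl 0) (Sum.inl 1) (Sum.inl 2) n⟫_ℂ ∧
      re ⟪e' (Sum.inl 0), vG e' (Sum.inl 0) (Sum.inl 1) (Sum.inl 2) n⟫_ℂ ≤ 0.7 := by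
    intro n; rw [inner_x0_vG he' h01 h02]; norm_num
  have H2 : ∀ n, (epsModel n : ℂ) =
      ⟪vG e' (Sum.inl 0) (Sum.inl 1) (Sum.inl 2) n,
        e' (Sum.inl 0) - vG e' (Sum.inl 0) (Sum.inl 1) (Sum.inl 2) n⟫_ℂ :=
    fun n => (inner_vG_x0_sub_vG he' h01 h02 n).symm
  have H3 : ∀ n, epsModel (n + 1) ≤ (1 - 1 / 2) * epsModel n := by
    intro n; rw [epsModel_succ]; norm_num
  have H4 : ∀ n, ‖⟪e' (Sum.inl 0), vG e' (Sum.inl 0) (Sum.inl 1) (Sum.inl 2) (n + 1) -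
      vG e' (Sum.inl 0) (Sum.inl 1) (Sum.inl 2) n⟫_ℂ‖ ≤ 10 * (1 / 2) * epsModel n := by
    intro n; rw [inner_e_stepG he' h01 h02, norm_zero]; have := epsModel_pos n; positivity
  have H5 : ∀ (i : Fin k) n, ⟪e' (Sum.inr i), vG e' (Sum.inl 0) (Sum.inl 1) (Sum.inl 2) (n + 1) -
      vG e' (Sum.inl 0) (Sum.inl 1) (Sum.inl 2) n⟫_ℂ = 0 :=
    fun i n => inner_e_stepG he' (by simp) (by simp) n
  have hall := hRC H' (e' (Sum.inl 0)) (fun i => e' (Sum.inr i)) (vG e' (Sum.inl 0) (Sum.inl 1) (Sum.inl 2))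
    epsModel (1 / 2) hx₀ hw hxw (by norm_num) (by norm_num)
    H1 H2 epsModel_pos epsModel_strictAnti epsModel_tendsto H3 H4 H5 1
  have hstep := norm_stepG_ge he' (i₀ := Sum.inl 0) h12 0
  simp only [zero_add] at hstep
  linarith

open RoomModel in
/-- **Finitely many exact constraints do not confine the iterate.**  For every `k` and every `ρ < 0.6`,
`RoomClaimFin k ρ` is false — witnessed in `EuclideanSpace ℂ (Fin 3 ⊕ Fin k)`, i.e. already in dimension `k + 3`. [cite: Enflo2023, v2 p.20, after (46)] -/
theorem not_roomClaimFin (k : ℕ) (ρ : ℝ) (hρ : ρ < 0.6) : ¬ RoomClaimFin k ρ := by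
  intro h
  exact modelFin_violates k ρ hρ h (EuclideanSpace ℂ (Fin 3 ⊕ Fin k))
    (fun i => EuclideanSpace.basisFun (Fin 3 ⊕ Fin k) ℂ i) (EuclideanSpace.basisFun (Fin 3 ⊕ Fin k) ℂ).orthonormal

/-- Sanity link: one constraint vector is the `k = 1` case up to the (weaker) hypotheses of `RoomClaim`;
precisely, `RoomClaim ρ → RoomClaimFin k ρ` for every `k ≥ 1` (use `w 0`). [cite: Enflo2023, v2 p.20, after (46)] -/
theorem roomClaimFin_of_roomClaim {ρ : ℝ} (h : RoomClaim ρ) (k : ℕ) (hk : 1 ≤ k) : RoomClaimFin k ρ := by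
  intro H _ _ _ x₀ w v εθ β hx₀ hw _hxw hβ hβ1 H1 H2 H3 H4 H5 H6 H7 H8 n
  have hw0 : w ⟨0, hk⟩ ≠ 0 := by
    intro h0; have := hw.1 ⟨0, hk⟩; rw [h0, norm_zero] at this; exact zero_ne_one this
  exact h H x₀ (w ⟨0, hk⟩) v εθ β hx₀ hw0 hβ hβ1 H1 H2 H3 H4 H5 H6 H7 (H8 ⟨0, hk⟩) n

end Literature.Analysis.OperatorTheory.Enflo2023
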